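import Summits.AtomisticToContinuum.HydrodynamicLimit.Theorems.AnnealedZeroHorizonMeanFluxClosureCollisionalStressClosureD
import Summits.AtomisticToContinuum.HydrodynamicLimit.Theorems.AntiMazurCoboundariesShearStressHalfDrudeMarginal
import HarnessLib

/-!
# Stub VIRIAL `stub_collisionalVirialClosure` of crux `MeanFluxClosure`
# (stmt-AtomisticToContinuum-9256, route AnnealedZeroHorizon, line `registered`): EOS-free part A —
# translation covariance of collision functionals; the mean of a shifted collisional stress in equilibrium

The stub asks for the mean closure of `c · collisionalStress (Dφ) ∘ Φ_{t₁} + J_φ − I_φ` (`c = (N+1)⁻¹`). Its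
EOS-free half — at CONSTANT profiles the collisional stress of `Dφ` has mean EXACTLY `0` under the homogeneous
local Gibbs law — is proved by TRANSLATION AVERAGING (part B, `…CollisionalVirialClosureB`). This file is the
pathwise and covariance machinery, for ARBITRARY pair kernels where possible:

* `collisionalTransferFunctional_congr_of_eqOn` — a collision functional over `(a, b]` only reads the curve on
  `(a, ∞)` (collision times, colliding pairs, left limits of a hard-sphere trajectory);
* `collisionalTransferFunctional_posShift` — GENERIC PATHWISE COVARIANCE: for the diagonal position shift
  `T_y z = (xᵢ + y, vᵢ)ᵢ` of a torus trajectory `γ`, the functional of ANY kernel `g` along `T_y ∘ γ` is the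
  functional along `γ` of the shifted kernel `(i, j, pre, post) ↦ g i j (T_y pre) (T_y post)` (collision times
  `collisionTimes_posShift`, contact pairs `posShift_mem_contactSet_iff`, left limits `leftLim_posShift`); for
  the stress kernel `stressKernel A ∘ T_y = stressKernel (A (· + y))` (`Torus.geometry_sepVec_add_right`), so
  `collisionalStress A (T_y ∘ γ) = collisionalStress (A (· + y)) γ` (`collisionalStress_posShift`);
* `collisionalTransferFunctional_flow_posShift`, `collisionalStress_flow_posShift` — along the flow: for good `z`
  with good `T_y z` and `t₁ ≥ 0` the functional of the time-`t₁` point of `T_y z` over `(0, h]` is the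
  shifted-kernel functional of the time-`t₁` point of `z` (`HardSphereFlow.flow_posShift_of_nonneg`, group
  property, locality in time); `G_N`-a.e. for every profile (`ae_collisionalStress_flow_posShift`);
* `continuous_collisionalTransferFunctional_param`, `integral_collisionalTransferFunctional_param` — along a
  trajectory the functional is a finite sum: continuous in, and integrable over, a parameter of the kernel
  (linearity in the kernel); `integral_stressKernel_translate`, `integral_collisionalStress_translate` — the
  `y`-average of `collisionalStress (A (· + y))` along a trajectory is the collisional stress of the CONSTANT
  field `∫_{𝕋ᵈ} A` (translation invariance of Haar measure);
* `integral_collisionalStress_translate_const` and its registered `∀`-form `stub_collisionalStressTranslateMean`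
  (sub-goal of stmt-AtomisticToContinuum-9256) — at constant profiles `G_N` is `T_y`-invariant
  (`ShearStressHalfDrudeMarginal.integral_comp_posShift_localGibbsLaw_const`), so
  `E[c · collisionalStress (A (· + y)) ∘ Φ_{t₁}] = E[c · collisionalStress A ∘ Φ_{t₁}]` for every shift `y`.

References: H. Spohn, *Large Scale Dynamics of Interacting Particles* (1991), Part I §2.3, §3.2 (3.7), (3.15);
I. Gallagher, L. Saint-Raymond, B. Texier, *From Newton to Boltzmann* (2013), §1.1, §4.2 (homogeneity of the
torus dynamics).
-/

noncomputable section

namespace Summit.AtomisticToContinuum.HydrodynamicLimit.Theorems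

open scoped BigOperators ENNReal Topology InnerProductSpace
open MeasureTheory Set Filter Function
open Literature.MathematicalPhysics.KineticTheory Literature.Analysis.FluidPDE Literature.Analysis.FunctionSpaces

namespace CollisionalVirialClosure

/-! ## Collision functionals only read the curve after the window starts -/

section Congr

variable {d : Type*} [Fintype d] {X : Type*} [TopologicalSpace X] [T2Space X] {N : ℕ} {ε : ℝ}
  {G : Geometry d X} {E : Type*} [AddCommMonoid E]

/-- **Locality in time.** If `γ₁` is a hard-sphere trajectory (continuous translations, Hausdorff positions)
and `γ₂` agrees with `γ₁` on `(a, ∞)`, then every collision functional over `(a, b]` agrees: collision times,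
colliding pairs and left limits at times `t > a` only read the curve on `(a, t]`. [folklore] -/
theorem collisionalTransferFunctional_congr_of_eqOn {γ₁ γ₂ : ℝ → Config N d X}
    (h₁ : IsHardSphereTrajectory G ε N γ₁) (hG : ∀ x : X, Continuous (G.translate x)) {a : ℝ}
    (heq : EqOn γ₁ γ₂ (Ioi a)) (g : Fin N → Fin N → Config N d X → Config N d X → E) (b : ℝ) :
    collisionalTransferFunctional G ε g γ₂ a b = collisionalTransferFunctional G ε g γ₁ a b := by
  have hT : collisionTimes G ε γ₂ ∩ Ioc a b = collisionTimes G ε γ₁ ∩ Ioc a b := by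
    ext t
    simp only [mem_inter_iff, mem_collisionTimes]
    constructor
    · rintro ⟨⟨i, j, hij, hc⟩, ht⟩
      exact ⟨⟨i, j, hij, by rwa [heq ht.1]⟩, ht⟩
    · rintro ⟨⟨i, j, hij, hc⟩, ht⟩
      exact ⟨⟨i, j, hij, by rwa [← heq ht.1]⟩, ht⟩
  have hleft : ∀ t ∈ Ioi a, Function.leftLim γ₂ t = Function.leftLim γ₁ t := by
    intro t ht
    refine leftLim_eq_of_tendsto ((h₁.tendsto_leftLim hG t).congr' ?_)
    filter_upwards [Ioo_mem_nhdsLT (mem_Ioi.1 ht)] with s hs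
    exact heq hs.1
  rw [collisionalTransferFunctional_def, collisionalTransferFunctional_def, hT]
  refine finsum_mem_congr rfl fun t ht => ?_
  rw [hleft t ht.2.1, ← heq ht.2.1]

end Congr

/-! ## Translation covariance of collision functionals on the torus -/

section Shift

variable {d : Type*} [Fintype d] {N : ℕ} {ε : ℝ}

/-- The colliding ordered pairs are invariant under the diagonal position shift. [folklore] -/
theorem collidingPairs_posShift (y : UnitAddTorus d) (z : Config N d (UnitAddTorus d)) :
    collidingPairs (Torus.geometry d) ε (fun i => ((z i).1 + y, (z i).2) : Config N d (UnitAddTorus d)) =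
      collidingPairs (Torus.geometry d) ε z := by
  ext p
  simp only [mem_collidingPairs, posShift_mem_contactSet_iff]

/-- Left limits of a hard-sphere trajectory commute with the (continuous) diagonal position shift. [folklore] -/
theorem leftLim_posShift {γ : ℝ → Config N d (UnitAddTorus d)}
    (h : IsHardSphereTrajectory (Torus.geometry d) ε N γ) (y : UnitAddTorus d) (t : ℝ) :
    Function.leftLim (fun s => (fun i => ((γ s i).1 + y, (γ s i).2) : Config N d (UnitAddTorus d))) t =
      fun i => ((Function.leftLim γ t i).1 + y, (Function.leftLim γ t i).2) :=
  leftLim_eq_of_tendsto (((continuous_posShift y).tendsto _).comp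
    (h.tendsto_leftLim Torus.continuous_geometry_translate t))

/-- **Generic pathwise translation covariance.** For a hard-sphere trajectory `γ` on `𝕋ᵈ`, every `y` and
EVERY pair kernel `g`, the collision functional along the shifted curve `T_y ∘ γ` over `(a, b]` is the
functional along `γ` of the shifted kernel `(i, j, pre, post) ↦ g i j (T_y pre) (T_y post)`. [folklore] -/
theorem collisionalTransferFunctional_posShift {E : Type*} [AddCommMonoid E]
    {γ : ℝ → Config N d (UnitAddTorus d)} (h : IsHardSphereTrajectory (Torus.geometry d) ε N γ)
    (y : UnitAddTorus d)
    (g : Fin N → Fin N → Config N d (UnitAddTorus d) → Config N d (UnitAddTorus d) → E) (a b : ℝ) :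
    collisionalTransferFunctional (Torus.geometry d) ε g
        (fun t => (fun i => ((γ t i).1 + y, (γ t i).2) : Config N d (UnitAddTorus d))) a b =
      collisionalTransferFunctional (Torus.geometry d) ε
        (fun i j pre post => g i j (fun k => ((pre k).1 + y, (pre k).2))
          (fun k => ((post k).1 + y, (post k).2))) γ a b := by
  rw [collisionalTransferFunctional_def, collisionalTransferFunctional_def, collisionTimes_posShift]
  refine finsum_mem_congr rfl fun t _ => ?_
  rw [leftLim_posShift h y t, collidingPairs_posShift]

/-- The stress kernel read off shifted configurations is the stress kernel of the shifted matrix field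
(the minimal-image separation is shift invariant). [folklore] -/
theorem stressKernel_posShift (A : UnitAddTorus d → EuclideanSpace ℝ d →L[ℝ] EuclideanSpace ℝ d)
    (y : UnitAddTorus d) (i j : Fin N) (pre post : Config N d (UnitAddTorus d)) :
    stressKernel (Torus.geometry d) A i j (fun k => ((pre k).1 + y, (pre k).2))
        (fun k => ((post k).1 + y, (post k).2)) =
      stressKernel (Torus.geometry d) (fun x => A (x + y)) i j pre post := by
  simp only [stressKernel_apply, Torus.geometry_sepVec_add_right]

/-- **Covariance of the collisional stress**: `collisionalStress A (T_y ∘ γ) = collisionalStress (A (· + y)) γ`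
along a torus trajectory. [folklore] -/
theorem collisionalStress_posShift {γ : ℝ → Config N d (UnitAddTorus d)}
    (h : IsHardSphereTrajectory (Torus.geometry d) ε N γ)
    (A : UnitAddTorus d → EuclideanSpace ℝ d →L[ℝ] EuclideanSpace ℝ d) (y : UnitAddTorus d) (a b : ℝ) :
    collisionalStress (Torus.geometry d) ε A
        (fun t => (fun i => ((γ t i).1 + y, (γ t i).2) : Config N d (UnitAddTorus d))) a b =
      collisionalStress (Torus.geometry d) ε (fun x => A (x + y)) γ a b := by
  rw [collisionalStress, collisionalStress, collisionalTransferFunctional_posShift h y]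
  simp only [stressKernel_posShift]

/-- **Covariance along the flow.** For a good datum `z` with good translate `T_y z` and `t₁ ≥ 0`, the
collision functional of kernel `g` of the time-`t₁` point of `T_y z` over `(0, h]` is the functional of the
shifted kernel of the time-`t₁` point of `z` (forward commutation `Φ_t ∘ T_y = T_y ∘ Φ_t`, group property,
locality in time). [folklore] -/
theorem collisionalTransferFunctional_flow_posShift {E : Type*} [AddCommMonoid E]
    (Φ : HardSphereFlow (Torus.geometry d) ε N)
    (g : Fin N → Fin N → Config N d (UnitAddTorus d) → Config N d (UnitAddTorus d) → E)
    (y : UnitAddTorus d) {z : Config N d (UnitAddTorus d)} (hz : z ∈ Φ.good)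
    (hzy : (fun i => ((z i).1 + y, (z i).2) : Config N d (UnitAddTorus d)) ∈ Φ.good)
    {t₁ : ℝ} (ht₁ : 0 ≤ t₁) (h : ℝ) :
    Φ.collisionalTransferFunctional g (Φ.flow t₁ (fun i => ((z i).1 + y, (z i).2))) h =
      Φ.collisionalTransferFunctional (fun i j pre post => g i j (fun k => ((pre k).1 + y, (pre k).2))
        (fun k => ((post k).1 + y, (post k).2))) (Φ.flow t₁ z) h := by
  have htraj : IsHardSphereTrajectory (Torus.geometry d) ε N fun τ =>
      Φ.flow τ (Φ.flow t₁ (fun i => ((z i).1 + y, (z i).2))) :=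
    Φ.isTrajectory _ (Φ.mapsTo_good t₁ hzy)
  have heq : EqOn (fun τ => Φ.flow τ (Φ.flow t₁ (fun i => ((z i).1 + y, (z i).2))))
      (fun τ => (fun i => ((Φ.flow τ (Φ.flow t₁ z) i).1 + y, (Φ.flow τ (Φ.flow t₁ z) i).2) :
        Config N d (UnitAddTorus d))) (Ioi 0) := by
    intro τ hτ
    have hτ' : 0 ≤ τ + t₁ := add_nonneg (le_of_lt hτ) ht₁
    dsimp only
    rw [← Φ.flow_add τ t₁ _ hzy, Φ.flow_posShift_of_nonneg y hz hzy hτ', Φ.flow_add τ t₁ _ hz]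
  rw [HardSphereFlow.collisionalTransferFunctional_eq, HardSphereFlow.collisionalTransferFunctional_eq,
    ← collisionalTransferFunctional_congr_of_eqOn htraj Torus.continuous_geometry_translate heq g h]
  exact collisionalTransferFunctional_posShift (Φ.isTrajectory _ (Φ.mapsTo_good t₁ hz)) y g 0 h

/-- Flow form for the collisional stress: `collisionalStress A (Φ_{t₁} (T_y z), h) =
collisionalStress (A (· + y)) (Φ_{t₁} z, h)` for good `z` with good translate and `t₁ ≥ 0`. [folklore] -/
theorem collisionalStress_flow_posShift (Φ : HardSphereFlow (Torus.geometry d) ε N)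
    (A : UnitAddTorus d → EuclideanSpace ℝ d →L[ℝ] EuclideanSpace ℝ d) (y : UnitAddTorus d)
    {z : Config N d (UnitAddTorus d)} (hz : z ∈ Φ.good)
    (hzy : (fun i => ((z i).1 + y, (z i).2) : Config N d (UnitAddTorus d)) ∈ Φ.good)
    {t₁ : ℝ} (ht₁ : 0 ≤ t₁) (h : ℝ) :
    Φ.collisionalStress A (Φ.flow t₁ (fun i => ((z i).1 + y, (z i).2))) h =
      Φ.collisionalStress (fun x => A (x + y)) (Φ.flow t₁ z) h := by
  simp only [HardSphereFlow.collisionalStress]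
  rw [collisionalTransferFunctional_flow_posShift Φ _ y hz hzy ht₁ h]
  simp only [stressKernel_posShift]

end Shift

/-! ## Linearity in the kernel: parametric continuity and integration; translation averages -/

section Param

variable {d : Type*} [Fintype d] {X : Type*} [TopologicalSpace X] {N : ℕ} {ε : ℝ}
  {G : Geometry d X} {γ : ℝ → Config N d X}

/-- **Parametric continuity**: along a hard-sphere trajectory a collision functional is a finite sum, so it
depends continuously on a parameter on which every kernel value depends continuously. [folklore] -/
theorem continuous_collisionalTransferFunctional_param {Y : Type*} [TopologicalSpace Y]
    {E : Type*} [AddCommMonoid E] [TopologicalSpace E] [ContinuousAdd E]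
    (h : IsHardSphereTrajectory G ε N γ) {g : Y → Fin N → Fin N → Config N d X → Config N d X → E}
    (hg : ∀ i j pre post, Continuous fun y => g y i j pre post) (a b : ℝ) :
    Continuous fun y => collisionalTransferFunctional G ε (g y) γ a b := by
  have hfin := h.finite_collisionTimes_inter_Ioc a b
  have hsum : ∀ g' : Fin N → Fin N → Config N d X → Config N d X → E,
      collisionalTransferFunctional G ε g' γ a b = ∑ t ∈ hfin.toFinset,
        ∑ p ∈ collidingPairs G ε (γ t), g' p.1 p.2 (Function.leftLim γ t) (γ t) :=
    fun g' => collisionalTransferFunctional_eq_sum g' hfin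
  simp only [hsum]
  exact continuous_finsetSum _ fun t _ => continuous_finsetSum _ fun p _ => hg _ _ _ _

/-- **Parametric integration (linearity in the kernel)**: along a hard-sphere trajectory, integrating a
collision functional over a parameter of the kernel gives the functional of the integrated kernel. [folklore] -/
theorem integral_collisionalTransferFunctional_param {Y : Type*} [MeasurableSpace Y] {μ : Measure Y}
    {E : Type*} [NormedAddCommGroup E] [NormedSpace ℝ E]
    (h : IsHardSphereTrajectory G ε N γ) {g : Y → Fin N → Fin N → Config N d X → Config N d X → E}
    (hg : ∀ i j pre post, Integrable (fun y => g y i j pre post) μ) (a b : ℝ) :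
    ∫ y, collisionalTransferFunctional G ε (g y) γ a b ∂μ =
      collisionalTransferFunctional G ε (fun i j pre post => ∫ y, g y i j pre post ∂μ) γ a b := by
  have hfin := h.finite_collisionTimes_inter_Ioc a b
  have hsum : ∀ g' : Fin N → Fin N → Config N d X → Config N d X → E,
      collisionalTransferFunctional G ε g' γ a b = ∑ t ∈ hfin.toFinset,
        ∑ p ∈ collidingPairs G ε (γ t), g' p.1 p.2 (Function.leftLim γ t) (γ t) :=
    fun g' => collisionalTransferFunctional_eq_sum g' hfin
  simp only [hsum]
  rw [integral_finsetSum _ fun t _ => integrable_finsetSum _ fun p _ => hg _ _ _ _]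
  refine Finset.sum_congr rfl fun t _ => ?_
  rw [integral_finsetSum _ fun p _ => hg _ _ _ _]

/-- The collisional stress of the zero matrix field vanishes (every curve, every window). [folklore] -/
theorem collisionalStress_zero (G : Geometry d X) (ε : ℝ) (γ : ℝ → Config N d X) (a b : ℝ) :
    collisionalStress G ε (fun _ => (0 : EuclideanSpace ℝ d →L[ℝ] EuclideanSpace ℝ d)) γ a b = 0 := by
  simp [collisionalStress, collisionalTransferFunctional_def]

end Param

section Average

variable {d : Type*} [Fintype d] {N : ℕ} {ε : ℝ}

/-- The stress kernel of the shifted field `A (· + y)` depends continuously on the shift `y`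
(continuous `A`). [folklore] -/
theorem continuous_stressKernel_translate {A : UnitAddTorus d → EuclideanSpace ℝ d →L[ℝ] EuclideanSpace ℝ d}
    (hA : Continuous A) (i j : Fin N) (pre post : Config N d (UnitAddTorus d)) :
    Continuous fun y => stressKernel (Torus.geometry d) (fun x => A (x + y)) i j pre post := by
  simp only [stressKernel_apply]
  exact continuous_const.mul (((hA.comp (continuous_const.add continuous_id)).clm_apply
    continuous_const).inner continuous_const)

/-- **Averaging the shifted stress kernel over the shift** gives the stress kernel of the CONSTANT field
`∫_{𝕋ᵈ} A` (linearity of `A ↦ ⟪A n, Δv⟫`, translation invariance of Haar measure). [folklore] -/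
theorem integral_stressKernel_translate {A : UnitAddTorus d → EuclideanSpace ℝ d →L[ℝ] EuclideanSpace ℝ d}
    (hA : Continuous A) (i j : Fin N) (pre post : Config N d (UnitAddTorus d)) :
    ∫ y, stressKernel (Torus.geometry d) (fun x => A (x + y)) i j pre post =
      stressKernel (Torus.geometry d) (fun _ => ∫ y, A y) i j pre post := by
  simp only [stressKernel_apply]
  have hAc : Continuous fun y => A ((post i).1 + y) := hA.comp (continuous_const.add continuous_id)
  rw [integral_const_mul]
  congr 1
  simp_rw [real_inner_comm ((post i).2 - (pre i).2)]
  rw [integral_inner (hAc.clm_apply continuous_const).integrable_unitAddTorus,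
    ← ContinuousLinearMap.integral_apply hAc.integrable_unitAddTorus, integral_add_left_eq_self]

/-- **Translation average of the collisional stress, pathwise**: along a torus hard-sphere trajectory,
`∫_y collisionalStress (A (· + y)) dy = collisionalStress (∫ A)` (the constant field). [folklore] -/
theorem integral_collisionalStress_translate {γ : ℝ → Config N d (UnitAddTorus d)}
    (h : IsHardSphereTrajectory (Torus.geometry d) ε N γ)
    {A : UnitAddTorus d → EuclideanSpace ℝ d →L[ℝ] EuclideanSpace ℝ d} (hA : Continuous A) (a b : ℝ) :
    ∫ y, collisionalStress (Torus.geometry d) ε (fun x => A (x + y)) γ a b =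
      collisionalStress (Torus.geometry d) ε (fun _ => ∫ y, A y) γ a b := by
  simp only [collisionalStress]
  rw [integral_collisionalTransferFunctional_param h
    (g := fun y => stressKernel (Torus.geometry d) fun x => A (x + y))
    (fun i j pre post => (continuous_stressKernel_translate hA i j pre post).integrable_unitAddTorus) a b]
  simp only [integral_stressKernel_translate hA]

end Average

/-! ## Under the local Gibbs law: covariance a.e., invariance of the mean at constant profiles, Fubini -/

section Gibbs

variable {σ : ℝ} {N : ℕ} (Φ : HardSphereFlow (Torus.geometry (Fin 3)) (hsDiameter σ N) (N + 1))

/-- `G_N`-a.e. covariance of the collisional stress along the flow (any profiles: `G_N ≪` Liouville, and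
Liouville-a.e. datum is good with good translate). [folklore] -/
theorem ae_collisionalStress_flow_posShift (a₀ θ₀ : T3 → ℝ) (u₀ : T3 → V3) (A : T3 → V3 →L[ℝ] V3) (y : T3)
    {t₁ : ℝ} (ht₁ : 0 ≤ t₁) (h : ℝ) :
    ∀ᵐ z ∂(localGibbsLaw σ a₀ u₀ θ₀ N Φ),
      Φ.collisionalStress A (Φ.flow t₁ (fun i => ((z i).1 + y, (z i).2))) h =
        Φ.collisionalStress (fun x => A (x + y)) (Φ.flow t₁ z) h := by
  have hμ := localGibbsLaw_absolutelyContinuous σ a₀ u₀ θ₀ N Φ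
  filter_upwards [hμ.ae_le Φ.ae_mem_good, hμ.ae_le (Φ.ae_posShift_mem_good y)] with z hz hzy
  exact collisionalStress_flow_posShift Φ A y hz hzy ht₁ h

/-- **The mean of a shifted collisional stress does not depend on the shift, in equilibrium**: for
constant profiles `E[c · collisionalStress (A (· + y)) ∘ Φ_{t₁}] = E[c · collisionalStress A ∘ Φ_{t₁}]`
(`G_N` is `T_y`-invariant, the flow is `T_y`-covariant a.e.). [folklore] -/
theorem integral_collisionalStress_translate_const (a θ : ℝ) (u : V3) (A : T3 → V3 →L[ℝ] V3) (y : T3)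
    {t₁ : ℝ} (ht₁ : 0 ≤ t₁) (h c : ℝ) :
    ∫ z, c * Φ.collisionalStress (fun x => A (x + y)) (Φ.flow t₁ z) h
        ∂(localGibbsLaw σ (fun _ => a) (fun _ => u) (fun _ => θ) N Φ) =
      ∫ z, c * Φ.collisionalStress A (Φ.flow t₁ z) h
        ∂(localGibbsLaw σ (fun _ => a) (fun _ => u) (fun _ => θ) N Φ) := by
  rw [← ShearStressHalfDrudeMarginal.integral_comp_posShift_localGibbsLaw_const σ a θ u N Φ y
    (fun z => c * Φ.collisionalStress A (Φ.flow t₁ z) h)]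
  refine integral_congr_ae ?_
  filter_upwards [ae_collisionalStress_flow_posShift Φ (fun _ => a) (fun _ => θ) (fun _ => u) A y ht₁ h]
    with z hz
  rw [hz]

end Gibbs

end CollisionalVirialClosure

open CollisionalVirialClosure in
/-- **Registered sub-goal `stub_collisionalStressTranslateMean` of stmt-AtomisticToContinuum-9256 (stub VIRIAL, EOS-free
covariance part).** For CONSTANT profiles `(a, u, θ)`, every `σ`, `N`, every hard-sphere flow `Φ` of `N + 1` spheres of
diameter `hsDiameter σ N`, every matrix field `A`, every shift `y ∈ 𝕋³`, all `t₁ ≥ 0`, `h`, `c`: the mean under the local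
Gibbs law of `c · collisionalStress (A (· + y)) (Φ_{t₁} ·, h)` equals that of `c · collisionalStress A (Φ_{t₁} ·, h)` —
the homogeneous Gibbs law is invariant under the diagonal position shift and the flow commutes with it almost
everywhere, while pathwise `collisionalStress A (T_y ∘ γ) = collisionalStress (A (· + y)) γ`. [folklore] -/
theorem stub_collisionalStressTranslateMean : ∀ (σ a θ : ℝ) (u : Literature.MathematicalPhysics.KineticTheory.V3) (N : ℕ) (Φ : Literature.Analysis.FluidPDE.HardSphereFlow (Literature.Analysis.FluidPDE.Torus.geometry (Fin 3)) (Literature.MathematicalPhysics.KineticTheory.hsDiameter σ N) (N + 1)) (A : Literature.MathematicalPhysics.KineticTheory.T3 → Literature.MathematicalPhysics.KineticTheory.V3 →L[ℝ] Literature.MathematicalPhysics.KineticTheory.V3) (y : Literature.MathematicalPhysics.KineticTheory.T3) (t₁ h c : ℝ), 0 ≤ t₁ → ∫ z, c * Φ.collisionalStress (fun x => A (x + y)) (Φ.flow t₁ z) h ∂Literature.MathematicalPhysics.KineticTheory.localGibbsLaw σ (fun _ => a) (fun _ => u) (fun _ => θ) N Φ = ∫ z, c * Φ.collisionalStress A (Φ.flow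 t₁ z) h ∂Literature.MathematicalPhysics.KineticTheory.localGibbsLaw σ (fun _ => a) (fun _ => u) (fun _ => θ) N Φ :=
  fun _σ a θ u _N Φ A y _t₁ h c ht₁ => integral_collisionalStress_translate_const Φ a θ u A y ht₁ h c

end Summit.AtomisticToContinuum.HydrodynamicLimit.Theorems
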